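/-
Copyright (c) 2026 the pub-hodgecm-mathlib formalisation cell (harness21).  Prover seat hodgecm-mathlib-K2Liu-p11 (g2), Track B «K2-LIT»,
#184♮ = hLiu418 = `stmt-HodgeConjecture-24832`; LEAD F0P6-plan (g14) BATCH #1 (γ) ∕ K2Liu-p11 (g2) 10:47Z (C1): the carriers of the
`𝔭^±`-derivatives of the scalar-type vector as FLAT scalar-parabolic families (the «`f_{s,τ′}`» of LEAD F0P6-plan (g13) 10:13:40Z (B)).
THEOREMS ONLY (no `def`, no `instance`, no notation, no named-fact hypothesis, no `sorry`).
-/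
import Summits.HodgeConjecture.HodgeConjecture.Theorems.K2LiuArchIntertwiningContinuedHalf    -- ★ (this seat): `differentiable_archScalarSection_param`
import Summits.HodgeConjecture.HodgeConjecture.Theorems.K2LiuArchInducedTubeSectionPrelims   -- ★ (this lineage): Siegel-parabolic letters
import HarnessLib

/-!
# Crux `HLiu418`, A∞ organ: the `𝔭^±`-carriers `φ^±_{b,s} = f⁰_{s,k} · T_b^{(±)}` are flat scalar-parabolic families

Cell `hodgecm-mathlib`, crux item hLiu418 = `stmt-HodgeConjecture-24832` (helper lane `--supports`, count-neutral).

★ (B) `K2LiuArchScalarSectionPDerivative.lieDeriv_pMinus ∕ lieDeriv_pPlus`: `𝔭⁻(b) • f⁰_{s,k} = (2s + l − k) · φ⁻_{b,s}` and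
`𝔭⁺(b) • f⁰_{s,k} = (2s + l + k) · φ⁺_{b,s}` with the CARRIERS
`φ⁻_{b,s}(g) = f⁰_{s,k}(g) · conj T_b(g)`, `φ⁺_{b,s}(g) = f⁰_{s,k}(g) · T_b(g)`, `T_b(g) = tr(Δ_g⁻¹ · denom g (−i1) · b)`,
`Δ_g = denom g (i1)`.  This file records what the U1-glob(σ) ∕ (CR) consumers need of a «flat family through a `K_w`-finite vector»:
* §0 `eq_of_isArchSiegelSection_of_eqOn_stab` — UNIQUENESS OF FLAT FAMILIES: two functions with the same Siegel-parabolic law that agree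
  on `U(J) ∩ Stab(i1)` agree on `U(J)` (`U(J) = P_Δ · Stab(i1)`, ★ H1-C);
* §1 `traceLetter_siegel_mul` — `T_b(p g) = T_b(g)` for EVERY `g` and every Siegel-parabolic `p` with `det p₂₂ ≠ 0` (on singular `Δ_g`
  both sides are computed with `Matrix.inv = 0`, so no `U(J)` hypothesis is needed), hence §2 the PARABOLIC LAW
  `IsArchSiegelSection χ_k s (φ^±_{b,s})` (★ `isArchSiegelSection_archScalarSection`);
* §3 FLATNESS: on `u ∈ U(J) ∩ Stab(i1)`, `φ⁻_{b,s}(u) = j(u,i1)^{−k} · conj T_b(u)` and `φ⁺_{b,s}(u) = j(u,i1)^{−k} · T_b(u)` — no `s`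
  (★ `norm_det_denom_of_stab`: `‖j(u,i1)‖ = 1`); at the identity `φ⁻_{b,s}(1) = conj tr b`, `φ⁺_{b,s}(1) = tr b`;
* §4 `s ↦ φ^±_{b,s}(h)` and `s ↦ φ^±_{b,−s}(h)` are ENTIRE for `h ∈ U(J)` (★ `differentiable_archScalarSection_param`).
So `s ↦ φ^±_{b,s}` IS «the flat family through `φ^±_{b,s₀}`» in the sense of the U1-glob(σ) arch clause (LEAD (F-a) 09:54:40Z), and any
other family with the same law and the same `K_w`-restriction coincides with it on `U(J)` (§0).
References: [Shimura1997, §§5–6, §16.4]; [Knapp1986, Ch. VI §2].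
HONEST LABEL: HC_CM is proved only modulo the 7 printed citations (2 remaining named inputs: hLiu418 = stmt-HodgeConjecture-24832,
h413 = stmt-HodgeConjecture-24833) until rung 0 closes; count-neutral helper, closes no socket.
-/

set_option autoImplicit false
set_option linter.dupNamespace false

noncomputable section

open Complex Matrix
open scoped ComplexConjugate

namespace Summit.HodgeConjecture.HodgeConjecture.Cruxes.HLiu418.K2LiuArchPMinusCarrier

open Literature.NumberTheory.ModularForms.SiegelUpperHalfSpace (num denom num_def denom_def denom_mul moeb)
open Summit.HodgeConjecture.HodgeConjecture.Cruxes.HLiu418.K2LiuHermitianTubeCocycle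
open Summit.HodgeConjecture.HodgeConjecture.Cruxes.HLiu418.K2LiuHermitianTubeAction
open Summit.HodgeConjecture.HodgeConjecture.Cruxes.HLiu418.K2LiuArchInducedTubeDefs
open Summit.HodgeConjecture.HodgeConjecture.Cruxes.HLiu418.K2LiuArchInducedTubeSection
open Summit.HodgeConjecture.HodgeConjecture.Cruxes.HLiu418.K2LiuArchInducedTubeSectionPrelims
open Summit.HodgeConjecture.HodgeConjecture.Cruxes.HLiu418.K2LiuArchIntertwiningContinuedHalf

variable {l : Type*} [Fintype l] [DecidableEq l]

/-! ## §0  Uniqueness of flat families: a section is determined by its restriction to `Stab(i1)` -/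

/-- **UNIQUENESS OF FLAT FAMILIES.**  Two functions with the same Siegel-parabolic law `IsArchSiegelSection χ s` which agree on
`U(J) ∩ Stab(i1)` agree on all of `U(J)` (`U(J) = P_Δ · Stab(i1)`, ★ H1-C `exists_transl_levi_mul_stabilizer`). [Shimura1997, §6.4, §16.4] -/
theorem eq_of_isArchSiegelSection_of_eqOn_stab {χ : ℂ → ℂ} {s : ℂ} {f f' : Matrix (l ⊕ l) (l ⊕ l) ℂ → ℂ}
    (hf : IsArchSiegelSection χ s f) (hf' : IsArchSiegelSection χ s f')
    (hK : ∀ u : Matrix (l ⊕ l) (l ⊕ l) ℂ, uᴴ * Matrix.J l ℂ * u = Matrix.J l ℂ → moeb u (I • (1 : Matrix l l ℂ)) = I • 1 → f u = f' u)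
    {g : Matrix (l ⊕ l) (l ⊕ l) ℂ} (hg : gᴴ * Matrix.J l ℂ * g = Matrix.J l ℂ) :
    f g = f' g := by
  obtain ⟨X, R, u, hX, hR, hRu, hu, huI, hgeq⟩ := exists_transl_levi_mul_stabilizer hg
  have hp : (fromBlocks 1 X 0 1 * fromBlocks R 0 0 R⁻¹ : Matrix (l ⊕ l) (l ⊕ l) ℂ)ᴴ * Matrix.J l ℂ *
      (fromBlocks 1 X 0 1 * fromBlocks R 0 0 R⁻¹) = Matrix.J l ℂ := transl_mul_levi_mem hX hR hRu
  have hp21 : (fromBlocks 1 X 0 1 * fromBlocks R 0 0 R⁻¹ : Matrix (l ⊕ l) (l ⊕ l) ℂ).toBlocks₂₁ = 0 := toBlocks₂₁_transl_mul_levi X R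
  rw [hgeq, hf _ u hp hp21, hf' _ u hp hp21, hK u hu huI]

/-! ## §1  The trace letter `T_b(g) = tr(Δ_g⁻¹ · denom g (−i1) · b)` is left-`P_Δ`-invariant -/

omit [DecidableEq l] in
/-- `denom (p g) Z = p₂₂ · denom g Z` for `p` in the Siegel parabolic, at EVERY `Z` (★ `denom_mul_of_siegel` is the case `Z = i1`).
[Shimura1997, §5.2] -/
theorem denom_mul_of_siegel_any {p : Matrix (l ⊕ l) (l ⊕ l) ℂ} (hp : p.toBlocks₂₁ = 0) (g : Matrix (l ⊕ l) (l ⊕ l) ℂ)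
    (Z : Matrix l l ℂ) : denom (p * g) Z = p.toBlocks₂₂ * denom g Z := by
  rw [denom_mul, hp, Matrix.zero_mul, zero_add]

/-- **`T_b(p g) = T_b(g)`** for every `g`, every `b` and every Siegel-parabolic `p` (`p₂₁ = 0`, `det p₂₂ ≠ 0`).  (If `Δ_g` is singular both
sides are computed with `Matrix.inv = 0` and vanish.) [Shimura1997, §16.4] -/
theorem traceLetter_siegel_mul {p : Matrix (l ⊕ l) (l ⊕ l) ℂ} (hp : p.toBlocks₂₁ = 0) (hD : IsUnit p.toBlocks₂₂.det)
    (g : Matrix (l ⊕ l) (l ⊕ l) ℂ) (b : Matrix l l ℂ) :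
    ((denom (p * g) (I • (1 : Matrix l l ℂ)))⁻¹ * denom (p * g) (-(I • (1 : Matrix l l ℂ))) * b).trace =
      ((denom g (I • (1 : Matrix l l ℂ)))⁻¹ * denom g (-(I • (1 : Matrix l l ℂ))) * b).trace := by
  rw [denom_mul_of_siegel_any hp, denom_mul_of_siegel_any hp]
  by_cases hΔ : IsUnit (denom g (I • (1 : Matrix l l ℂ))).det
  · rw [Matrix.mul_inv_rev, Matrix.mul_assoc (denom g (I • (1 : Matrix l l ℂ)))⁻¹, ← Matrix.mul_assoc (p.toBlocks₂₂)⁻¹,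
      Matrix.nonsing_inv_mul _ hD, Matrix.one_mul]
  · have h1 : (denom g (I • (1 : Matrix l l ℂ)))⁻¹ = 0 := Matrix.nonsing_inv_apply_not_isUnit _ hΔ
    have h2 : (p.toBlocks₂₂ * denom g (I • (1 : Matrix l l ℂ)))⁻¹ = 0 := by
      refine Matrix.nonsing_inv_apply_not_isUnit _ ?_
      rw [det_mul]
      intro h
      exact hΔ (isUnit_of_mul_isUnit_right h)
    simp only [h1, h2, Matrix.zero_mul]

/-! ## §2  The parabolic law of the carriers -/

/-- **`φ⁻_{b,s} ∈ I_w(s, χ_k)`**: the `𝔭⁻`-carrier `g ↦ f⁰_{s,k}(g) · conj T_b(g)` has the scalar Siegel-parabolic law of weight `k`.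
[Shimura1997, §16.4] -/
theorem isArchSiegelSection_pMinusCarrier (k : ℤ) (s : ℂ) (b : Matrix l l ℂ) :
    IsArchSiegelSection (l := l) (fun z : ℂ => (conj z / ((‖z‖ : ℝ) : ℂ)) ^ k) s
      (fun g => archScalarSection k s g *
        conj (((denom g (I • (1 : Matrix l l ℂ)))⁻¹ * denom g (-(I • (1 : Matrix l l ℂ))) * b).trace)) := by
  intro p g hP hp
  have hD : IsUnit p.toBlocks₂₂.det := by
    obtain ⟨hne, h22⟩ := det_toBlocks₂₂_of_mem_siegel hP hp
    rw [h22]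
    exact isUnit_iff_ne_zero.mpr (inv_ne_zero ((map_ne_zero _).mpr hne))
  simp only
  rw [isArchSiegelSection_archScalarSection k s p g hP hp, traceLetter_siegel_mul hp hD]
  ring

/-- **`φ⁺_{b,s} ∈ I_w(s, χ_k)`**: the `𝔭⁺`-carrier `g ↦ f⁰_{s,k}(g) · T_b(g)` has the scalar Siegel-parabolic law of weight `k`.
[Shimura1997, §16.4] -/
theorem isArchSiegelSection_pPlusCarrier (k : ℤ) (s : ℂ) (b : Matrix l l ℂ) :
    IsArchSiegelSection (l := l) (fun z : ℂ => (conj z / ((‖z‖ : ℝ) : ℂ)) ^ k) s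
      (fun g => archScalarSection k s g * ((denom g (I • (1 : Matrix l l ℂ)))⁻¹ * denom g (-(I • (1 : Matrix l l ℂ))) * b).trace) := by
  intro p g hP hp
  have hD : IsUnit p.toBlocks₂₂.det := by
    obtain ⟨hne, h22⟩ := det_toBlocks₂₂_of_mem_siegel hP hp
    rw [h22]
    exact isUnit_iff_ne_zero.mpr (inv_ne_zero ((map_ne_zero _).mpr hne))
  simp only
  rw [isArchSiegelSection_archScalarSection k s p g hP hp, traceLetter_siegel_mul hp hD]
  ring

/-! ## §3  Flatness: the restriction to `Stab(i1)` does not depend on `s` -/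

/-- On the stabiliser, the scalar-type vector is the pure `K_w`-character: `f⁰_{s,k}(u) = j(u,i1)^{−k}` for `u ∈ U(J) ∩ Stab(i1)` — no `s`
(`‖j(u,i1)‖ = 1`, ★ `norm_det_denom_of_stab`). [Shimura1997, §16.4] -/
theorem archScalarSection_stab (k : ℤ) (s : ℂ) {u : Matrix (l ⊕ l) (l ⊕ l) ℂ} (hu : uᴴ * Matrix.J l ℂ * u = Matrix.J l ℂ)
    (huI : moeb u (I • (1 : Matrix l l ℂ)) = I • 1) :
    archScalarSection k s u = (denom u (I • (1 : Matrix l l ℂ))).det ^ (-k) := by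
  rw [archScalarSection_apply, norm_det_denom_of_stab hu huI, Complex.ofReal_one, Complex.one_cpow, mul_one]

/-- **FLATNESS OF `φ⁻`**: `φ⁻_{b,s}(u) = j(u,i1)^{−k} · conj T_b(u)` on `U(J) ∩ Stab(i1)` — independent of `s`. [Shimura1997, §16.4] -/
theorem pMinusCarrier_stab (k : ℤ) (s : ℂ) (b : Matrix l l ℂ) {u : Matrix (l ⊕ l) (l ⊕ l) ℂ}
    (hu : uᴴ * Matrix.J l ℂ * u = Matrix.J l ℂ) (huI : moeb u (I • (1 : Matrix l l ℂ)) = I • 1) :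
    archScalarSection k s u * conj (((denom u (I • (1 : Matrix l l ℂ)))⁻¹ * denom u (-(I • (1 : Matrix l l ℂ))) * b).trace) =
      (denom u (I • (1 : Matrix l l ℂ))).det ^ (-k) *
        conj (((denom u (I • (1 : Matrix l l ℂ)))⁻¹ * denom u (-(I • (1 : Matrix l l ℂ))) * b).trace) := by
  rw [archScalarSection_stab k s hu huI]

/-- **FLATNESS OF `φ⁺`**: `φ⁺_{b,s}(u) = j(u,i1)^{−k} · T_b(u)` on `U(J) ∩ Stab(i1)` — independent of `s`. [Shimura1997, §16.4] -/
theorem pPlusCarrier_stab (k : ℤ) (s : ℂ) (b : Matrix l l ℂ) {u : Matrix (l ⊕ l) (l ⊕ l) ℂ}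
    (hu : uᴴ * Matrix.J l ℂ * u = Matrix.J l ℂ) (huI : moeb u (I • (1 : Matrix l l ℂ)) = I • 1) :
    archScalarSection k s u * ((denom u (I • (1 : Matrix l l ℂ)))⁻¹ * denom u (-(I • (1 : Matrix l l ℂ))) * b).trace =
      (denom u (I • (1 : Matrix l l ℂ))).det ^ (-k) *
        ((denom u (I • (1 : Matrix l l ℂ)))⁻¹ * denom u (-(I • (1 : Matrix l l ℂ))) * b).trace := by
  rw [archScalarSection_stab k s hu huI]

/-- Two flat scalar-type values of `φ⁻` at different parameters agree on the stabiliser: `φ⁻_{b,s}(u) = φ⁻_{b,s′}(u)`. [Shimura1997, §16.4] -/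
theorem pMinusCarrier_stab_eq (k : ℤ) (s s' : ℂ) (b : Matrix l l ℂ) {u : Matrix (l ⊕ l) (l ⊕ l) ℂ}
    (hu : uᴴ * Matrix.J l ℂ * u = Matrix.J l ℂ) (huI : moeb u (I • (1 : Matrix l l ℂ)) = I • 1) :
    archScalarSection k s u * conj (((denom u (I • (1 : Matrix l l ℂ)))⁻¹ * denom u (-(I • (1 : Matrix l l ℂ))) * b).trace) =
      archScalarSection k s' u * conj (((denom u (I • (1 : Matrix l l ℂ)))⁻¹ * denom u (-(I • (1 : Matrix l l ℂ))) * b).trace) := by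
  rw [archScalarSection_stab k s hu huI, archScalarSection_stab k s' hu huI]

/-- The trace letter at the identity: `T_b(1) = tr b` (`denom 1 Z = 1`). [folklore] -/
theorem traceLetter_one (b : Matrix l l ℂ) :
    ((denom (1 : Matrix (l ⊕ l) (l ⊕ l) ℂ) (I • (1 : Matrix l l ℂ)))⁻¹ *
        denom (1 : Matrix (l ⊕ l) (l ⊕ l) ℂ) (-(I • (1 : Matrix l l ℂ))) * b).trace = b.trace := by
  have h1 : ∀ Z : Matrix l l ℂ, denom (1 : Matrix (l ⊕ l) (l ⊕ l) ℂ) Z = 1 := fun Z => by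
    rw [denom_def, ← fromBlocks_one, toBlocks_fromBlocks₂₁, toBlocks_fromBlocks₂₂, Matrix.zero_mul, zero_add]
  rw [h1, h1, inv_one, Matrix.one_mul, Matrix.one_mul]

/-- **`φ⁻_{b,s}(1) = conj (tr b)`**. [folklore] -/
theorem pMinusCarrier_one (k : ℤ) (s : ℂ) (b : Matrix l l ℂ) :
    archScalarSection k s (1 : Matrix (l ⊕ l) (l ⊕ l) ℂ) *
        conj (((denom (1 : Matrix (l ⊕ l) (l ⊕ l) ℂ) (I • (1 : Matrix l l ℂ)))⁻¹ *
          denom (1 : Matrix (l ⊕ l) (l ⊕ l) ℂ) (-(I • (1 : Matrix l l ℂ))) * b).trace) = conj b.trace := by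
  rw [archScalarSection_one, traceLetter_one, one_mul]

/-- **`φ⁺_{b,s}(1) = tr b`**. [folklore] -/
theorem pPlusCarrier_one (k : ℤ) (s : ℂ) (b : Matrix l l ℂ) :
    archScalarSection k s (1 : Matrix (l ⊕ l) (l ⊕ l) ℂ) *
        ((denom (1 : Matrix (l ⊕ l) (l ⊕ l) ℂ) (I • (1 : Matrix l l ℂ)))⁻¹ *
          denom (1 : Matrix (l ⊕ l) (l ⊕ l) ℂ) (-(I • (1 : Matrix l l ℂ))) * b).trace = b.trace := by
  rw [archScalarSection_one, traceLetter_one, one_mul]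

/-! ## §4  Holomorphy in `s` -/

/-- **`s ↦ φ⁻_{b,s}(h)` IS ENTIRE** for `h ∈ U(J)`. [Shimura1997, §16.4] -/
theorem differentiable_pMinusCarrier_param (k : ℤ) (b : Matrix l l ℂ) {h : Matrix (l ⊕ l) (l ⊕ l) ℂ}
    (hh : hᴴ * Matrix.J l ℂ * h = Matrix.J l ℂ) :
    Differentiable ℂ (fun s : ℂ => archScalarSection k s h *
      conj (((denom h (I • (1 : Matrix l l ℂ)))⁻¹ * denom h (-(I • (1 : Matrix l l ℂ))) * b).trace)) :=
  (differentiable_archScalarSection_param k hh).mul (differentiable_const _)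

/-- **`s ↦ φ⁻_{b,−s}(h)` IS ENTIRE** for `h ∈ U(J)` (the form in which the intertwined family appears). [Shimura1997, §16.4] -/
theorem differentiable_pMinusCarrier_neg_param (k : ℤ) (b : Matrix l l ℂ) {h : Matrix (l ⊕ l) (l ⊕ l) ℂ}
    (hh : hᴴ * Matrix.J l ℂ * h = Matrix.J l ℂ) :
    Differentiable ℂ (fun s : ℂ => archScalarSection k (-s) h *
      conj (((denom h (I • (1 : Matrix l l ℂ)))⁻¹ * denom h (-(I • (1 : Matrix l l ℂ))) * b).trace)) :=
  (differentiable_archScalarSection_neg_param k hh).mul (differentiable_const _)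

/-- **`s ↦ φ⁺_{b,s}(h)` IS ENTIRE** for `h ∈ U(J)`. [Shimura1997, §16.4] -/
theorem differentiable_pPlusCarrier_param (k : ℤ) (b : Matrix l l ℂ) {h : Matrix (l ⊕ l) (l ⊕ l) ℂ}
    (hh : hᴴ * Matrix.J l ℂ * h = Matrix.J l ℂ) :
    Differentiable ℂ (fun s : ℂ => archScalarSection k s h *
      ((denom h (I • (1 : Matrix l l ℂ)))⁻¹ * denom h (-(I • (1 : Matrix l l ℂ))) * b).trace) :=
  (differentiable_archScalarSection_param k hh).mul (differentiable_const _)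

/-- **`s ↦ φ⁺_{b,−s}(h)` IS ENTIRE** for `h ∈ U(J)`. [Shimura1997, §16.4] -/
theorem differentiable_pPlusCarrier_neg_param (k : ℤ) (b : Matrix l l ℂ) {h : Matrix (l ⊕ l) (l ⊕ l) ℂ}
    (hh : hᴴ * Matrix.J l ℂ * h = Matrix.J l ℂ) :
    Differentiable ℂ (fun s : ℂ => archScalarSection k (-s) h *
      ((denom h (I • (1 : Matrix l l ℂ)))⁻¹ * denom h (-(I • (1 : Matrix l l ℂ))) * b).trace) :=
  (differentiable_archScalarSection_neg_param k hh).mul (differentiable_const _)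

/-- **THE FLAT FAMILY THROUGH `φ⁻_{b,s₀}` IS `s ↦ φ⁻_{b,s}`, AND IT IS THE ONLY ONE**: any family `F s` with the weight-`k` Siegel-parabolic
law whose restriction to `U(J) ∩ Stab(i1)` is that of `φ⁻_{b,s₀}` equals `φ⁻_{b,s}` on `U(J)` (§0 + §2 + §3). [Shimura1997, §16.4] -/
theorem eq_pMinusCarrier_of_flat (k : ℤ) (s s₀ : ℂ) (b : Matrix l l ℂ) {F : Matrix (l ⊕ l) (l ⊕ l) ℂ → ℂ}
    (hF : IsArchSiegelSection (fun z : ℂ => (conj z / ((‖z‖ : ℝ) : ℂ)) ^ k) s F)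
    (hK : ∀ u : Matrix (l ⊕ l) (l ⊕ l) ℂ, uᴴ * Matrix.J l ℂ * u = Matrix.J l ℂ → moeb u (I • (1 : Matrix l l ℂ)) = I • 1 →
      F u = archScalarSection k s₀ u *
        conj (((denom u (I • (1 : Matrix l l ℂ)))⁻¹ * denom u (-(I • (1 : Matrix l l ℂ))) * b).trace))
    {g : Matrix (l ⊕ l) (l ⊕ l) ℂ} (hg : gᴴ * Matrix.J l ℂ * g = Matrix.J l ℂ) :
    F g = archScalarSection k s g * conj (((denom g (I • (1 : Matrix l l ℂ)))⁻¹ * denom g (-(I • (1 : Matrix l l ℂ))) * b).trace) :=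
  eq_of_isArchSiegelSection_of_eqOn_stab hF (isArchSiegelSection_pMinusCarrier k s b)
    (fun u hu huI => by rw [hK u hu huI, pMinusCarrier_stab_eq k s₀ s b hu huI]) hg

end Summit.HodgeConjecture.HodgeConjecture.Cruxes.HLiu418.K2LiuArchPMinusCarrier

end
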